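import Summits.CriticalPhenomena.SAWScalingLimit.Theorems.SAWDefectDecoherenceBoundaryClosureRLocalL1SmoothToContinuous
import HarnessLib

/-!
# Polygon limit data, I: two measure-theoretic dualities
(crux `BoundaryClosureR`, stmt-CriticalPhenomena-14004, line `polygon-parity-squeeze`, registered
stub `polygonLimitData` = piece C1 of the (A) assembly of `stub_polygonIdentification`)

Pure analysis used to turn the weak-* limits of the normalised bulk functionals into `L¹` data:

* `setIntegral_norm_le_of_pairing_bound`, `integrableOn_of_pairing_bound` — a function `g`
  continuous on an open `V ⊆ ℂ` whose pairings `∫ ψ g` with continuous compactly supported `ψ`,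
  `tsupport ψ ⊆ V`, `‖ψ‖ ≤ 1`, are bounded by `C` is integrable on `V` with `∫_V ‖g‖ ≤ C`
  (test against `χ · conj g / (‖g‖ + ε)`, dominated convergence `ε → 0`, compact exhaustion);
* `measure_eq_zero_of_forall_integral_eq_zero` — a measure finite on the compacts of an open `U`
  all of whose integrals against non-negative continuous compactly supported functions supported in
  an open `O ⊆ U` vanish gives `O` measure `0` (Urysohn functions on a compact exhaustion of `O`;
  no regularity of the measure is needed).
-/

noncomputable section

open scoped Topology ENNReal ComplexConjugate
open Filter Set MeasureTheory Metric

namespace Summit.CriticalPhenomena.SAWScalingLimit.Theorems.PolygonParitySqueeze.PolygonLimitData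

/-! ### 0. Compact exhaustions of open subsets of `ℂ` -/

/-- **Monotone compact exhaustion of an open subset of `ℂ`.** [folklore] -/
theorem exists_compact_exhaustion_iUnion {V : Set ℂ} (hV : IsOpen V) :
    ∃ K : ℕ → Set ℂ, (∀ n, IsCompact (K n)) ∧ (∀ n, K n ⊆ V) ∧ Monotone K ∧ ⋃ n, K n = V := by
  haveI : LocallyCompactSpace V := hV.locallyCompactSpace
  set KX := CompactExhaustion.choice V
  refine ⟨fun n => ((↑) : V → ℂ) '' (KX n), fun n => (KX.isCompact n).image continuous_subtype_val,
    fun n => Subtype.coe_image_subset _ _, fun m n hmn => image_mono (KX.subset hmn), ?_⟩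
  simp only [← image_iUnion, KX.iUnion_eq, image_univ, Subtype.range_coe]

/-- **Urysohn cut-offs inside an open set.** For a compact `L` inside an open `V ⊆ ℂ` there is a
continuous compactly supported `χ : ℂ → ℝ` with values in `[0, 1]`, `χ = 1` on `L` and
`tsupport χ ⊆ V`. [folklore] -/
theorem exists_cutoff {V L : Set ℂ} (hV : IsOpen V) (hL : IsCompact L) (hLV : L ⊆ V) :
    ∃ χ : ℂ → ℝ, Continuous χ ∧ HasCompactSupport χ ∧ tsupport χ ⊆ V ∧ (∀ z ∈ L, χ z = 1) ∧
      ∀ z, 0 ≤ χ z ∧ χ z ≤ 1 := by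
  obtain ⟨L', hL'c, hLL', hL'V⟩ := exists_compact_between hL hV hLV
  obtain ⟨χ, hχ1, hχ0, hχc, hχ01⟩ := exists_continuous_one_zero_of_isCompact hL
    isOpen_interior.isClosed_compl (disjoint_compl_right_iff_subset.2 hLL')
  refine ⟨χ, χ.continuous, hχc, ?_, fun z hz => hχ1 hz, fun z => (hχ01 z)⟩
  refine (closure_minimal (fun z hz => ?_) hL'c.isClosed).trans hL'V
  by_contra h
  exact hz (hχ0 (fun h' => h (interior_subset h')))

/-! ### 1. `L¹` bounds from bounded pairings with continuous test functions -/

/-- **`L¹` on compacts from bounded pairings.** Let `g` be continuous on an open `V ⊆ ℂ` and suppose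
`‖∫ ψ g‖ ≤ C` for every continuous compactly supported `ψ` with `tsupport ψ ⊆ V` and `‖ψ‖ ≤ 1`.
Then `∫_L ‖g‖ ≤ C` for every compact `L ⊆ V`.  Proof: test against
`ψ_ε = χ · conj g / (‖g‖ + ε)` (`χ` a cut-off equal to `1` on `L`), so that
`∫_L ‖g‖²/(‖g‖ + ε) ≤ ∫ ψ_ε g ≤ C`, and let `ε → 0` by dominated convergence. [folklore] -/
theorem setIntegral_norm_le_of_pairing_bound {V : Set ℂ} (hV : IsOpen V) {g : ℂ → ℂ}
    (hg : ContinuousOn g V) {C : ℝ}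
    (hC : ∀ ψ : ℂ → ℂ, Continuous ψ → HasCompactSupport ψ → tsupport ψ ⊆ V →
      (∀ z, ‖ψ z‖ ≤ 1) → ‖∫ z, ψ z * g z‖ ≤ C)
    {L : Set ℂ} (hL : IsCompact L) (hLV : L ⊆ V) :
    ∫ z in L, ‖g z‖ ≤ C := by
  obtain ⟨χ, hχ, hχc, hχV, hχL, hχ01⟩ := exists_cutoff hV hL hLV
  -- the regularisation parameter `ε n = 1/(n+1)`
  set ε : ℕ → ℝ := fun n => 1 / ((n : ℝ) + 1) with hε
  have hε0 : ∀ n, 0 < ε n := fun n => by rw [hε]; positivity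
  have hεt : Tendsto ε atTop (𝓝 0) := tendsto_one_div_add_atTop_nhds_zero_nat
  -- the regularised moduli `q n = ‖g‖² / (‖g‖ + ε n)`
  set q : ℕ → ℂ → ℝ := fun n z => ‖g z‖ ^ 2 / (‖g z‖ + ε n) with hq
  have hq0 : ∀ n z, 0 ≤ q n z := fun n z => by
    rw [hq]; exact div_nonneg (sq_nonneg _) (by linarith [norm_nonneg (g z), hε0 n])
  have hqle : ∀ n z, q n z ≤ ‖g z‖ := fun n z => by
    rw [hq]
    dsimp only
    rw [div_le_iff₀ (by linarith [norm_nonneg (g z), hε0 n])]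
    nlinarith [norm_nonneg (g z), hε0 n]
  -- the test functions `ψ n = χ · conj g / (‖g‖ + ε n)`
  set ψ : ℕ → ℂ → ℂ := fun n z => (χ z : ℂ) * (conj (g z) / (((‖g z‖ + ε n : ℝ)) : ℂ)) with hψ
  have hden : ∀ n z, (((‖g z‖ + ε n : ℝ)) : ℂ) ≠ 0 := fun n z =>
    Complex.ofReal_ne_zero.2 (by linarith [norm_nonneg (g z), hε0 n])
  have hχ' : Continuous fun z => (χ z : ℂ) := Complex.continuous_ofReal.comp hχ
  have hχt : tsupport (fun z => (χ z : ℂ)) ⊆ V := (tsupport_comp_subset Complex.ofReal_zero χ).trans hχV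
  have hψcont : ∀ n, Continuous (ψ n) := by
    intro n
    refine PickHalfPlane.LocalL1.continuous_mul_of_tsupport_subset hV subset_rfl hχ' hχt ?_
    refine (Complex.continuous_conj.comp_continuousOn hg).div ?_ fun z _ => hden n z
    exact Complex.continuous_ofReal.comp_continuousOn (hg.norm.add continuousOn_const)
  have hψsupp : ∀ n, tsupport (ψ n) ⊆ V := fun n =>
    (tsupport_mul_subset_left (f := fun z => (χ z : ℂ))).trans hχt
  have hψc : ∀ n, HasCompactSupport (ψ n) := fun n =>
    (hχc.comp_left Complex.ofReal_zero).mul_right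
  have hψ1 : ∀ n z, ‖ψ n z‖ ≤ 1 := by
    intro n z
    have hpos : 0 < ‖g z‖ + ε n := by linarith [norm_nonneg (g z), hε0 n]
    have h1 : ‖(χ z : ℂ)‖ ≤ 1 := by
      rw [Complex.norm_real, Real.norm_of_nonneg (hχ01 z).1]; exact (hχ01 z).2
    have h2 : ‖conj (g z) / (((‖g z‖ + ε n : ℝ)) : ℂ)‖ ≤ 1 := by
      rw [norm_div, Complex.norm_conj, Complex.norm_real, Real.norm_of_nonneg hpos.le,
        div_le_one hpos]
      linarith [hε0 n]
    calc ‖ψ n z‖ = ‖(χ z : ℂ)‖ * ‖conj (g z) / (((‖g z‖ + ε n : ℝ)) : ℂ)‖ := norm_mul _ _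
      _ ≤ 1 * 1 := mul_le_mul h1 h2 (norm_nonneg _) zero_le_one
      _ = 1 := one_mul _
  -- the pairing is the real integral of `χ q n`
  have hprod : ∀ n z, ψ n z * g z = ((χ z * q n z : ℝ) : ℂ) := by
    intro n z
    simp only [hψ, hq]
    rw [mul_assoc, div_mul_eq_mul_div, Complex.conj_mul']
    push_cast
    ring
  have hint : ∀ n, Integrable (fun z => χ z * q n z) := by
    intro n
    have h1 : Continuous fun z => ψ n z * g z :=
      PickHalfPlane.LocalL1.continuous_mul_of_tsupport_subset hV subset_rfl (hψcont n) (hψsupp n) hg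
    have h2 : Integrable (fun z => ψ n z * g z) := h1.integrable_of_hasCompactSupport (hψc n).mul_right
    have h3 := h2.re
    refine h3.congr (Eventually.of_forall fun z => ?_)
    show RCLike.re (ψ n z * g z) = χ z * q n z
    rw [hprod]; exact Complex.ofReal_re _
  have hbound : ∀ n, ∫ z, χ z * q n z ≤ C := by
    intro n
    have h := hC (ψ n) (hψcont n) (hψc n) (hψsupp n) (hψ1 n)
    have hofR : (∫ z, ((χ z * q n z : ℝ) : ℂ)) = ((∫ z, χ z * q n z : ℝ) : ℂ) := integral_ofReal
    have heq : ∫ z, ψ n z * g z = ((∫ z, χ z * q n z : ℝ) : ℂ) := by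
      rw [← hofR]; exact integral_congr_ae (Eventually.of_forall (hprod n))
    rw [heq, Complex.norm_real, Real.norm_eq_abs] at h
    exact (le_abs_self _).trans h
  -- hence `∫_L q n ≤ C`
  have hLq : ∀ n, ∫ z in L, q n z ≤ C := by
    intro n
    have h1 : ∫ z in L, q n z = ∫ z in L, χ z * q n z :=
      setIntegral_congr_fun hL.measurableSet fun z hz => by rw [hχL z hz, one_mul]
    rw [h1]
    refine (setIntegral_le_integral (hint n) (Eventually.of_forall fun z => ?_)).trans (hbound n)
    exact mul_nonneg (hχ01 z).1 (hq0 n z)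
  -- dominated convergence on `L`
  have hgL : IntegrableOn (fun z => ‖g z‖) L := (hg.mono hLV).norm.integrableOn_compact hL
  have hlim : Tendsto (fun n => ∫ z in L, q n z) atTop (𝓝 (∫ z in L, ‖g z‖)) := by
    refine tendsto_integral_of_dominated_convergence (fun z => ‖g z‖) (fun n => ?_) hgL
      (fun n => Eventually.of_forall fun z => ?_) (Eventually.of_forall fun z => ?_)
    · refine ContinuousOn.aestronglyMeasurable ?_ hL.measurableSet
      have hc : ContinuousOn (fun z => ‖g z‖) L := (hg.mono hLV).norm
      exact (hc.pow 2).div (hc.add continuousOn_const) fun z _ => by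
        linarith [norm_nonneg (g z), hε0 n]
    · rw [Real.norm_of_nonneg (hq0 n z)]; exact hqle n z
    · by_cases hz : ‖g z‖ = 0
      · have : ∀ n, q n z = 0 := fun n => by simp only [hq, hz]; simp
        simp only [this, hz]; exact tendsto_const_nhds
      · have hpos : 0 < ‖g z‖ := lt_of_le_of_ne (norm_nonneg _) (Ne.symm hz)
        have h1 : Tendsto (fun n => ‖g z‖ ^ 2 / (‖g z‖ + ε n)) atTop (𝓝 (‖g z‖ ^ 2 / (‖g z‖ + 0))) :=
          (tendsto_const_nhds.div (tendsto_const_nhds.add hεt) (by rw [add_zero]; exact hpos.ne'))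
        have e : ‖g z‖ ^ 2 / (‖g z‖ + 0) = ‖g z‖ := by
          rw [add_zero, sq, mul_div_assoc, div_self hpos.ne', mul_one]
        rw [e] at h1
        exact h1
  exact le_of_tendsto' hlim hLq

/-- **`L¹` on the open set from bounded pairings.** Under the hypotheses of
`setIntegral_norm_le_of_pairing_bound`, `g` is integrable on `V` and `∫_V ‖g‖ ≤ C` (compact
exhaustion and monotone convergence). [folklore] -/
theorem integrableOn_of_pairing_bound {V : Set ℂ} (hV : IsOpen V) {g : ℂ → ℂ}
    (hg : ContinuousOn g V) {C : ℝ}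
    (hC : ∀ ψ : ℂ → ℂ, Continuous ψ → HasCompactSupport ψ → tsupport ψ ⊆ V →
      (∀ z, ‖ψ z‖ ≤ 1) → ‖∫ z, ψ z * g z‖ ≤ C) :
    IntegrableOn g V ∧ ∫ z in V, ‖g z‖ ≤ C := by
  have hC0 : 0 ≤ C := by
    have h := hC 0 continuous_const HasCompactSupport.zero (by rw [tsupport_zero]; exact empty_subset _)
      (fun z => by simp)
    simpa using h
  obtain ⟨K, hKc, hKV, hKm, hKU⟩ := exists_compact_exhaustion_iUnion hV
  have hmeas : AEStronglyMeasurable g (volume.restrict V) := hg.aestronglyMeasurable hV.measurableSet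
  -- the Lebesgue integral of `‖g‖ₑ` over `V` is the supremum over the exhaustion
  have hsup : ∫⁻ z in V, ‖g z‖ₑ = ⨆ n, ∫⁻ z in K n, ‖g z‖ₑ := by
    rw [← hKU]
    exact setLIntegral_iUnion_of_directed _ hKm.directed_le
  have hKn : ∀ n, ∫⁻ z in K n, ‖g z‖ₑ ≤ ENNReal.ofReal C := by
    intro n
    have hint : IntegrableOn g (K n) := (hg.mono (hKV n)).integrableOn_compact (hKc n)
    rw [← ofReal_integral_norm_eq_lintegral_enorm hint]
    exact ENNReal.ofReal_le_ofReal
      (setIntegral_norm_le_of_pairing_bound hV hg hC (hKc n) (hKV n))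
  have hle : ∫⁻ z in V, ‖g z‖ₑ ≤ ENNReal.ofReal C := by rw [hsup]; exact iSup_le hKn
  refine ⟨⟨hmeas, ?_⟩, ?_⟩
  · exact hasFiniteIntegral_iff_enorm.2 (hle.trans_lt ENNReal.ofReal_lt_top)
  · rw [integral_norm_eq_lintegral_enorm hmeas]
    exact ENNReal.toReal_le_of_le_ofReal hC0 hle

/-! ### 2. Vanishing of a measure on an open set from vanishing integrals -/

/-- **Vanishing on an open set from vanishing integrals.** Let `μ` be a measure on `ℂ` finite on the
compact subsets of an open `U`, and `O ⊆ U` open.  If `∫ w dμ = 0` for every non-negative continuous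
compactly supported `w` with `tsupport w ⊆ O`, then `μ O = 0`: every compact `K ⊆ O` carries a
Urysohn function `w ≥ 1_K`, so `μ K ≤ ∫ w dμ = 0`, and `O` is a countable union of compacts.
[folklore] -/
theorem measure_eq_zero_of_forall_integral_eq_zero {μ : Measure ℂ} {U O : Set ℂ} (hO : IsOpen O)
    (hOU : O ⊆ U) (hfin : ∀ K : Set ℂ, IsCompact K → K ⊆ U → μ K < ⊤)
    (h0 : ∀ w : ℂ → ℝ, Continuous w → HasCompactSupport w → tsupport w ⊆ O → (∀ z, 0 ≤ w z) →
      ∫ z, w z ∂μ = 0) :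
    μ O = 0 := by
  obtain ⟨K, hKc, hKO, -, hKU⟩ := exists_compact_exhaustion_iUnion hO
  have hK0 : ∀ n, μ (K n) = 0 := by
    intro n
    obtain ⟨w, hw, hwc, hwO, hwK, hw01⟩ := exists_cutoff hO (hKc n) (hKO n)
    -- `w` is `μ`-integrable: bounded by `1`, supported in a compact of `U`
    have hSfin : μ (tsupport w) < ⊤ := hfin _ hwc (hwO.trans hOU)
    have hwint : Integrable w μ := by
      refine (integrableOn_iff_integrable_of_support_subset (subset_tsupport w)).1 ?_
      exact Measure.integrableOn_of_bounded (M := 1) hSfin.ne hw.aestronglyMeasurable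
        (Eventually.of_forall fun z => by rw [Real.norm_of_nonneg (hw01 z).1]; exact (hw01 z).2)
    -- `μ K ≤ ∫ w dμ = 0`
    have h1 : μ (K n) ≤ ∫⁻ z, ENNReal.ofReal (w z) ∂μ := by
      rw [← lintegral_indicator_one (hKc n).measurableSet]
      refine lintegral_mono fun z => ?_
      by_cases hz : z ∈ K n
      · rw [indicator_of_mem hz, hwK z hz]; simp
      · rw [indicator_of_notMem hz]; exact zero_le
    rw [← ofReal_integral_eq_lintegral_ofReal hwint (Eventually.of_forall fun z => (hw01 z).1),
      h0 w hw hwc hwO fun z => (hw01 z).1, ENNReal.ofReal_zero] at h1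
    exact le_antisymm h1 zero_le
  rw [← hKU]
  exact measure_iUnion_null hK0

/-! ### Registered form -/

/-- **Registered helper `polygonLimitData_duality`** (crux item stmt-CriticalPhenomena-14004, line
`polygon-parity-squeeze`, sub-goal of the stub `polygonLimitData`): registry form (one `∀`-term) of
`integrableOn_of_pairing_bound`. [folklore] -/
theorem polygonLimitData_duality : ∀ (V : Set ℂ) (g : ℂ → ℂ) (C : ℝ), IsOpen V → ContinuousOn g V → (∀ ψ : ℂ → ℂ, Continuous ψ → HasCompactSupport ψ → tsupport ψ ⊆ V → (∀ z, ‖ψ z‖ ≤ 1) → ‖∫ z, ψ z * g z‖ ≤ C) → MeasureTheory.IntegrableOn g V ∧ ∫ z in V, ‖g z‖ ≤ C :=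
  fun _ _ _ hV hg hC => integrableOn_of_pairing_bound hV hg hC

end Summit.CriticalPhenomena.SAWScalingLimit.Theorems.PolygonParitySqueeze.PolygonLimitData

end
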